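import Mathlib

/-!
# Beta / SaddleInverse — typed kernel algebra of the CAP lane's (S3)–(S4): the explicit inverse of a saddle (bordered,
# KKT) matrix by KERNEL PAIRING and the tree-pinning SUB-BLOCK identity
# (β sub-cell, CAP lane «KERNEL ALGEBRA + EXPORT», lineage `b2b-balaban-beta-cap3`, gen 10; item R5′(i) of the gen-9 addendum
# memo `HOME/b2b-balaban-beta-cap3/g9/CAPSPLIT-cap3-g9-add1.md` §A.5–A.6, handed over in `HANDOFF-cap3-g9.md` §3(3); the mode-sum
# algebra (S1)–(S2) is the companion leaf `Beta/ModeSum.lean` — neither file imports the other)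

The one-loop integrand of the cell is a trace functional of the inverse of a fibre matrix `k_off(q)` = (centre-alias
deflated block Hessian) bordered by the block-averaging constraints, in the tree (axial) gauge.  The addendum memo located
the structure of that inverse numerically (residuals ≤ 1e-13 at 27 complex momenta, jobs J11–J13 = j084816, j084883,
j084968 — FLOATS, orientation only, nothing below depends on them):
* (S3) TREE PINNING.  Realise the tree gauge by Lagrange multipliers instead of by deleting variables: the big saddle matrix
  `K_big = [[A, B♭], [B, 0]]` on (all bonds) ⊕ (block constraints ⊕ tree rows) has
  `(K_big⁻¹)[non-tree bonds ∪ block multipliers] = k_off⁻¹` EXACTLY, whatever the tree–tree, tree–non-tree and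
  tree-constraint entries are (§2 below: `inv_pinned_toBlocks₁₁`, `inv_kBig_apply`, `isUnit_det_kBig_iff`).
* (S4) KERNEL PAIRING.  When `A` is singular but `dim ker A` = number of conditions, and the conditions see the kernel
  non-degenerately — `V := B·N` and `Ṽ := L·B♭` invertible for a kernel matrix `N` (`A N = 0`) and a co-kernel matrix `L`
  through which the defect of a generalised inverse `G` factors (`A G = 1 − Y L`) — then `[[A, B♭], [B, 0]]` is invertible
  with the EXPLICIT inverse `[[(1 − N V⁻¹ B) G (1 − B♭ Ṽ⁻¹ L), N V⁻¹], [Ṽ⁻¹ L, 0]]`: the multiplier–multiplier block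
  vanishes identically and the multiplier row is `Ṽ⁻¹ L` (§1: `saddle_mul_pairingInv`, `inv_saddle_eq_pairingInv`,
  `inv_saddle_toBlocks₂₂`, `saddle_solution`).  In the cell `V`, `Ṽ` are the two 84 × 84 axial-gauge Faddeev–Popov matrices
  at complex momentum and `G = A^#` is the fine-Parseval group inverse.
* (S1)–(S2) — the mode-sum structure of `A` and of its group inverse `A^#`, which supplies the hypotheses `A N = 0` and
  `A G = 1 − Y L` in the cell — is `Beta/ModeSum.lean`.

Everything is stated for matrices over an arbitrary commutative ring `R` with arbitrary finite index types, so it applies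
verbatim to the engines' exact-rational objects and to `ℂ`.

HONEST FRAMING.  Kernel algebra only, [folklore] throughout (block Gaussian elimination; generalised inverses in the sense
of the group ∕ {1,2}-inverse identities, which appear here only as HYPOTHESES and CONCLUSIONS about explicit products —
no `Matrix.pinv` theory is used or asserted).  This module proves NO bound, NO number of the β-function, NO statement
about Bałaban's operators and NO instance for the cell's concrete 408 × 408 ∕ 248 × 248 matrices (those live in the
engines); it discharges NOTHING of `FlowStep.BetaPertH`.  Its value is that the objects whose norms the lane's remaining
certificate (Z2) must control — `V⁻¹`, `Ṽ⁻¹`, `A^#` and the composite `(1 − N V⁻¹ B) A^# (1 − B♭ Ṽ⁻¹ L)` — are now the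
kernel-checked block entries of `k_off⁻¹`, not a numerical observation.  Discharging `BetaPertH` would make Bałaban's
ultraviolet stability unconditional — NOT the continuum limit and NOT the Clay problem.  0 `sorry`, 0 cite tags, imports
Mathlib only.
-/

namespace Summit.QuantumFields.BalabanUV.Beta.SaddleInverse

open Matrix

variable {R : Type*} [CommRing R]

/-! ## §1 Kernel pairing: the explicit inverse of the saddle matrix `[[A, B♭], [B, 0]]` (S4) -/

section Pairing

variable {n m k l : Type*} [Fintype n] [Fintype m] [Fintype k] [Fintype l] [DecidableEq n] [DecidableEq m] [DecidableEq l]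

/-- The saddle (bordered ∕ KKT) matrix `[[A, B♭], [B, 0]]`; `B♭` need not be `Bᵀ`. [folklore] -/
def saddle (A : Matrix n n R) (Bf : Matrix n m R) (B : Matrix m n R) : Matrix (n ⊕ m) (n ⊕ m) R :=
  fromBlocks A Bf B 0

/-- The kernel-pairing candidate inverse `[[(1 − N Vi B) G (1 − B♭ Wi L), N Vi], [Wi L, 0]]`, where `Vi`, `Wi` are meant to
be inverses of the pairing matrices `V = B N`, `Ṽ = L B♭`. [folklore] -/
def pairingInv (Bf : Matrix n m R) (B : Matrix m n R) (G : Matrix n n R) (N : Matrix n k R) (L : Matrix l n R)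
    (Vi : Matrix k m R) (Wi : Matrix m l R) : Matrix (n ⊕ m) (n ⊕ m) R :=
  fromBlocks ((1 - N * Vi * B) * G * (1 - Bf * Wi * L)) (N * Vi) (Wi * L) 0

variable {A : Matrix n n R} {Bf : Matrix n m R} {B : Matrix m n R} {G : Matrix n n R} {N : Matrix n k R}
  {L : Matrix l n R} {Vi : Matrix k m R} {Wi : Matrix m l R} {Y : Matrix n l R}

/-- KERNEL PAIRING (S4): if `A N = 0`, the defect of `G` factors through `L` (`A G = 1 − Y L`), and `Vi`, `Wi` are right
inverses of `B N`, `L B♭`, then `pairingInv` is a right inverse of the saddle matrix.  Only these four identities are used.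
[folklore] -/
theorem saddle_mul_pairingInv (hAN : A * N = 0) (hAG : A * G = 1 - Y * L) (hV : B * N * Vi = 1)
    (hW : L * Bf * Wi = 1) : saddle A Bf B * pairingInv Bf B G N L Vi Wi = 1 := by
  rw [saddle, pairingInv, fromBlocks_multiply, ← fromBlocks_one, fromBlocks_inj]
  have hP : A * (1 - N * Vi * B) = A := by
    rw [Matrix.mul_sub, Matrix.mul_one, ← Matrix.mul_assoc, ← Matrix.mul_assoc, hAN, Matrix.zero_mul,
      Matrix.zero_mul, sub_zero]
  have hQ : L * (1 - Bf * Wi * L) = 0 := by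
    rw [Matrix.mul_sub, Matrix.mul_one, ← Matrix.mul_assoc, ← Matrix.mul_assoc, hW, Matrix.one_mul, sub_self]
  have hB : B * (1 - N * Vi * B) = 0 := by
    rw [Matrix.mul_sub, Matrix.mul_one, ← Matrix.mul_assoc, ← Matrix.mul_assoc, hV, Matrix.one_mul, sub_self]
  refine ⟨?_, ?_, ?_, ?_⟩
  · rw [← Matrix.mul_assoc A, ← Matrix.mul_assoc A, hP, hAG, Matrix.sub_mul, Matrix.one_mul, Matrix.mul_assoc Y, hQ,
      Matrix.mul_zero, sub_zero, ← Matrix.mul_assoc Bf, sub_add_cancel]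
  · rw [← Matrix.mul_assoc, hAN, Matrix.zero_mul, Matrix.mul_zero, add_zero]
  · rw [← Matrix.mul_assoc B, ← Matrix.mul_assoc B, hB, Matrix.zero_mul, Matrix.zero_mul, Matrix.zero_mul, add_zero]
  · rw [← Matrix.mul_assoc, hV, Matrix.zero_mul, add_zero]

/-- … hence (square matrices over a commutative ring) also a left inverse. [folklore] -/
theorem pairingInv_mul_saddle (hAN : A * N = 0) (hAG : A * G = 1 - Y * L) (hV : B * N * Vi = 1)
    (hW : L * Bf * Wi = 1) : pairingInv Bf B G N L Vi Wi * saddle A Bf B = 1 :=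
  mul_eq_one_comm.mp (saddle_mul_pairingInv hAN hAG hV hW)

/-- … hence the saddle matrix is invertible, [folklore] -/
theorem isUnit_det_saddle (hAN : A * N = 0) (hAG : A * G = 1 - Y * L) (hV : B * N * Vi = 1)
    (hW : L * Bf * Wi = 1) : IsUnit (saddle A Bf B).det :=
  Matrix.isUnit_det_of_right_inverse (saddle_mul_pairingInv hAN hAG hV hW)

/-- … and its inverse IS the kernel-pairing formula. [folklore] -/
theorem inv_saddle_eq_pairingInv (hAN : A * N = 0) (hAG : A * G = 1 - Y * L) (hV : B * N * Vi = 1)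
    (hW : L * Bf * Wi = 1) : (saddle A Bf B)⁻¹ = pairingInv Bf B G N L Vi Wi :=
  Matrix.inv_eq_right_inv (saddle_mul_pairingInv hAN hAG hV hW)

/-- The multiplier–multiplier block of the inverse VANISHES identically (`G_λλ ≡ 0`, addendum §A.4). [folklore] -/
theorem inv_saddle_toBlocks₂₂ (hAN : A * N = 0) (hAG : A * G = 1 - Y * L) (hV : B * N * Vi = 1)
    (hW : L * Bf * Wi = 1) : ((saddle A Bf B)⁻¹).toBlocks₂₂ = 0 := by
  rw [inv_saddle_eq_pairingInv hAN hAG hV hW, pairingInv, toBlocks_fromBlocks₂₂]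

/-- The multiplier row of the inverse is `Ṽ⁻¹ L` (the multipliers depend on the force `f` only). [folklore] -/
theorem inv_saddle_toBlocks₂₁ (hAN : A * N = 0) (hAG : A * G = 1 - Y * L) (hV : B * N * Vi = 1)
    (hW : L * Bf * Wi = 1) : ((saddle A Bf B)⁻¹).toBlocks₂₁ = Wi * L := by
  rw [inv_saddle_eq_pairingInv hAN hAG hV hW, pairingInv, toBlocks_fromBlocks₂₁]

/-- The variable–multiplier column of the inverse is `N V⁻¹`. [folklore] -/
theorem inv_saddle_toBlocks₁₂ (hAN : A * N = 0) (hAG : A * G = 1 - Y * L) (hV : B * N * Vi = 1)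
    (hW : L * Bf * Wi = 1) : ((saddle A Bf B)⁻¹).toBlocks₁₂ = N * Vi := by
  rw [inv_saddle_eq_pairingInv hAN hAG hV hW, pairingInv, toBlocks_fromBlocks₁₂]

/-- The variable–variable block of the inverse is the composite `(1 − N V⁻¹ B) G (1 − B♭ Ṽ⁻¹ L)`. [folklore] -/
theorem inv_saddle_toBlocks₁₁ (hAN : A * N = 0) (hAG : A * G = 1 - Y * L) (hV : B * N * Vi = 1)
    (hW : L * Bf * Wi = 1) : ((saddle A Bf B)⁻¹).toBlocks₁₁ = (1 - N * Vi * B) * G * (1 - Bf * Wi * L) := by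
  rw [inv_saddle_eq_pairingInv hAN hAG hV hW, pairingInv, toBlocks_fromBlocks₁₁]

/-- The composite block does not depend on WHICH generalised inverse `G` (with defect through `L`) is used. [folklore] -/
theorem composite_indep {G' : Matrix n n R} {Y' : Matrix n l R} (hAN : A * N = 0) (hAG : A * G = 1 - Y * L)
    (hAG' : A * G' = 1 - Y' * L) (hV : B * N * Vi = 1) (hW : L * Bf * Wi = 1) :
    (1 - N * Vi * B) * G * (1 - Bf * Wi * L) = (1 - N * Vi * B) * G' * (1 - Bf * Wi * L) := by
  rw [← inv_saddle_toBlocks₁₁ hAN hAG hV hW, ← inv_saddle_toBlocks₁₁ hAN hAG' hV hW]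

/-- SOLUTION FORMULA: the saddle system `A v + B♭ λ = f`, `B v = g` is solved by `λ = Ṽ⁻¹ L f`,
`v = (1 − N V⁻¹ B) G (1 − B♭ Ṽ⁻¹ L) f + N V⁻¹ g` (addendum §A.5 (S4), there with `G = A^#`). [folklore] -/
theorem saddle_solution (hAN : A * N = 0) (hAG : A * G = 1 - Y * L) (hV : B * N * Vi = 1) (hW : L * Bf * Wi = 1)
    (f : n → R) (g : m → R) :
    (saddle A Bf B)⁻¹ *ᵥ Sum.elim f g =
      Sum.elim (((1 - N * Vi * B) * G * (1 - Bf * Wi * L)) *ᵥ f + (N * Vi) *ᵥ g) ((Wi * L) *ᵥ f) := by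
  rw [inv_saddle_eq_pairingInv hAN hAG hV hW, pairingInv, fromBlocks_mulVec, Sum.elim_comp_inl, Sum.elim_comp_inr,
    Matrix.zero_mulVec, add_zero]

end Pairing

/-! ## §2 Decoupled corner and TREE PINNING: the sub-block identity (S3) -/

section SubBlock

variable {o t : Type*} [Fintype o] [Fintype t] [DecidableEq o] [DecidableEq t]

/-- Candidate inverse of `[[K, Rm], [S, T]]` when the corner coupling `Rm T⁻¹ S` vanishes. [folklore] -/
def decoupledInv (Ki : Matrix o o R) (Rm : Matrix o t R) (S : Matrix t o R) (Ti : Matrix t t R) :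
    Matrix (o ⊕ t) (o ⊕ t) R :=
  fromBlocks Ki (-(Ki * Rm * Ti)) (-(Ti * S * Ki)) (Ti + Ti * S * Ki * Rm * Ti)

variable {K Ki : Matrix o o R} {Rm : Matrix o t R} {S : Matrix t o R} {T Ti : Matrix t t R}

/-- If `K Ki = 1`, `T Ti = 1` and `Rm Ti S = 0` then `decoupledInv` is a right inverse of `[[K, Rm], [S, T]]`. [folklore] -/
theorem fromBlocks_mul_decoupledInv (hK : K * Ki = 1) (hT : T * Ti = 1) (h0 : Rm * Ti * S = 0) :
    fromBlocks K Rm S T * decoupledInv Ki Rm S Ti = 1 := by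
  rw [decoupledInv, fromBlocks_multiply, ← fromBlocks_one, fromBlocks_inj]
  refine ⟨?_, ?_, ?_, ?_⟩
  · rw [hK, Matrix.mul_neg, ← Matrix.mul_assoc, ← Matrix.mul_assoc, h0, Matrix.zero_mul, neg_zero, add_zero]
  · have e : Rm * (Ti * S * Ki * Rm * Ti) = Rm * Ti * S * Ki * Rm * Ti := by simp only [← Matrix.mul_assoc]
    rw [Matrix.mul_neg, ← Matrix.mul_assoc, ← Matrix.mul_assoc, hK, Matrix.one_mul, Matrix.mul_add, e, h0,
      Matrix.zero_mul, Matrix.zero_mul, Matrix.zero_mul, add_zero, neg_add_cancel]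
  · rw [Matrix.mul_neg, ← Matrix.mul_assoc, ← Matrix.mul_assoc, hT, Matrix.one_mul, add_neg_cancel]
  · have e : T * (Ti * S * Ki * Rm * Ti) = T * Ti * S * Ki * Rm * Ti := by simp only [← Matrix.mul_assoc]
    have e' : S * (Ki * Rm * Ti) = S * Ki * Rm * Ti := by simp only [← Matrix.mul_assoc]
    rw [Matrix.mul_neg, Matrix.mul_add, hT, e, hT, Matrix.one_mul, e', add_comm (1 : Matrix t t R), neg_add_cancel_left]

/-- Hence, for invertible `K`, `T` with `Rm T⁻¹ S = 0`: the inverse of `[[K, Rm], [S, T]]` is `decoupledInv K⁻¹ Rm S T⁻¹`,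
[folklore] -/
theorem inv_fromBlocks_of_decoupled (hK : IsUnit K.det) (hT : IsUnit T.det) (h0 : Rm * T⁻¹ * S = 0) :
    (fromBlocks K Rm S T)⁻¹ = decoupledInv K⁻¹ Rm S T⁻¹ :=
  Matrix.inv_eq_right_inv (fromBlocks_mul_decoupledInv (Matrix.mul_nonsing_inv K hK) (Matrix.mul_nonsing_inv T hT) h0)

/-- … in particular its top-left block is `K⁻¹` — the SUB-BLOCK IDENTITY, [folklore] -/
theorem inv_fromBlocks_toBlocks₁₁_of_decoupled (hK : IsUnit K.det) (hT : IsUnit T.det) (h0 : Rm * T⁻¹ * S = 0) :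
    ((fromBlocks K Rm S T)⁻¹).toBlocks₁₁ = K⁻¹ := by
  rw [inv_fromBlocks_of_decoupled hK hT h0, decoupledInv, toBlocks_fromBlocks₁₁]

/-- … its determinant factorises as `det T · det K`, [folklore] -/
theorem det_fromBlocks_of_decoupled (K : Matrix o o R) (hT : IsUnit T.det) (h0 : Rm * T⁻¹ * S = 0) :
    (fromBlocks K Rm S T).det = T.det * K.det := by
  letI : Invertible T := Matrix.invertibleOfIsUnitDet T hT
  rw [Matrix.det_fromBlocks₂₂, Matrix.invOf_eq_nonsing_inv, h0, sub_zero]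

/-- … and it is invertible iff `K` is. [folklore] -/
theorem isUnit_det_fromBlocks_iff_of_decoupled (K : Matrix o o R) (hT : IsUnit T.det) (h0 : Rm * T⁻¹ * S = 0) :
    IsUnit (fromBlocks K Rm S T).det ↔ IsUnit K.det := by
  rw [det_fromBlocks_of_decoupled K hT h0, IsUnit.mul_iff, and_iff_right hT]

end SubBlock

section TreePin

variable {o c t : Type*} [Fintype o] [Fintype c] [Fintype t] [DecidableEq o] [DecidableEq c] [DecidableEq t]

/-- The tree-pinning corner `[[A_tt, 1], [1, 0]]`: the tree–tree Hessian block bordered by the pinning rows `a_b = 0`,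
`b ∈ tree`, and their multipliers. [folklore] -/
def treePin (Att : Matrix t t R) : Matrix (t ⊕ t) (t ⊕ t) R := fromBlocks Att 1 1 0

/-- Its explicit inverse `[[0, 1], [1, −A_tt]]`, whatever `A_tt` is. [folklore] -/
def treePinInv (Att : Matrix t t R) : Matrix (t ⊕ t) (t ⊕ t) R := fromBlocks 0 1 1 (-Att)

/-- The off-diagonal corner `[[A_ot, 0], [C_t, 0]]` (rows: non-tree bonds ⊕ block multipliers; columns: tree bonds ⊕ tree
multipliers). [folklore] -/
def cornerR (Aot : Matrix o t R) (Ct : Matrix c t R) : Matrix (o ⊕ c) (t ⊕ t) R := fromBlocks Aot 0 Ct 0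

/-- The off-diagonal corner `[[A_to, C_t♭], [0, 0]]`. [folklore] -/
def cornerS (Ato : Matrix t o R) (Ctf : Matrix t c R) : Matrix (t ⊕ t) (o ⊕ c) R := fromBlocks Ato Ctf 0 0

/-- The PINNED matrix: `K` (= `k_off`) in the top-left corner, the tree bonds ⊕ tree multipliers in the bottom-right corner.
[folklore] -/
def pinned (K : Matrix (o ⊕ c) (o ⊕ c) R) (Aot : Matrix o t R) (Ct : Matrix c t R) (Ato : Matrix t o R)
    (Ctf : Matrix t c R) (Att : Matrix t t R) : Matrix ((o ⊕ c) ⊕ (t ⊕ t)) ((o ⊕ c) ⊕ (t ⊕ t)) R :=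
  fromBlocks K (cornerR Aot Ct) (cornerS Ato Ctf) (treePin Att)

/-- `treePin Att * treePinInv Att = 1`. [folklore] -/
theorem treePin_mul (Att : Matrix t t R) : treePin Att * treePinInv Att = 1 := by
  rw [treePin, treePinInv, fromBlocks_multiply, ← fromBlocks_one, fromBlocks_inj]
  refine ⟨?_, ?_, ?_, ?_⟩ <;> simp

/-- [folklore] -/
theorem inv_treePin (Att : Matrix t t R) : (treePin Att)⁻¹ = treePinInv Att :=
  Matrix.inv_eq_right_inv (treePin_mul Att)

/-- [folklore] -/
theorem isUnit_det_treePin (Att : Matrix t t R) : IsUnit (treePin Att).det :=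
  Matrix.isUnit_det_of_right_inverse (treePin_mul Att)

omit [Fintype o] [Fintype c] [DecidableEq o] [DecidableEq c] in
/-- The corner coupling through the tree-pinning block VANISHES, for arbitrary tree–non-tree Hessian blocks `A_ot`, `A_to`
and arbitrary constraint entries on tree bonds `C_t`, `C_t♭` (so nothing below depends on how the block-averaging
functional is extended to tree bonds — addendum §A.5 (S3)). [folklore] -/
theorem treePin_coupling (Aot : Matrix o t R) (Ct : Matrix c t R) (Ato : Matrix t o R) (Ctf : Matrix t c R)
    (Att : Matrix t t R) : cornerR Aot Ct * (treePin Att)⁻¹ * cornerS Ato Ctf = 0 := by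
  rw [inv_treePin, cornerR, treePinInv, cornerS, fromBlocks_multiply, fromBlocks_multiply, ← fromBlocks_zero,
    fromBlocks_inj]
  refine ⟨?_, ?_, ?_, ?_⟩ <;> simp

/-- TREE PINNING, block form (S3): the top-left block of the inverse of the pinned matrix is `K⁻¹` (= `k_off⁻¹`).
[folklore] -/
theorem inv_pinned_toBlocks₁₁ (K : Matrix (o ⊕ c) (o ⊕ c) R) (Aot : Matrix o t R) (Ct : Matrix c t R)
    (Ato : Matrix t o R) (Ctf : Matrix t c R) (Att : Matrix t t R) (hK : IsUnit K.det) :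
    ((pinned K Aot Ct Ato Ctf Att)⁻¹).toBlocks₁₁ = K⁻¹ :=
  inv_fromBlocks_toBlocks₁₁_of_decoupled hK (isUnit_det_treePin Att) (treePin_coupling Aot Ct Ato Ctf Att)

/-- … and the pinned matrix is invertible iff `K` is. [folklore] -/
theorem isUnit_det_pinned_iff (K : Matrix (o ⊕ c) (o ⊕ c) R) (Aot : Matrix o t R) (Ct : Matrix c t R)
    (Ato : Matrix t o R) (Ctf : Matrix t c R) (Att : Matrix t t R) :
    IsUnit (pinned K Aot Ct Ato Ctf Att).det ↔ IsUnit K.det :=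
  isUnit_det_fromBlocks_iff_of_decoupled K (isUnit_det_treePin Att) (treePin_coupling Aot Ct Ato Ctf Att)

/-- The regrouping `(o ⊕ c) ⊕ (t ⊕ t) ≃ (o ⊕ t) ⊕ (c ⊕ t)` between «(non-tree bonds ⊕ block multipliers) ⊕ (tree bonds ⊕
tree multipliers)» and the native indexing «bonds ⊕ conditions» of `K_big = [[A, B♭], [B, 0]]`. [folklore] -/
def regroup (o c t : Type*) : (o ⊕ c) ⊕ (t ⊕ t) ≃ (o ⊕ t) ⊕ (c ⊕ t) where
  toFun
    | Sum.inl (Sum.inl i) => Sum.inl (Sum.inl i)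
    | Sum.inl (Sum.inr a) => Sum.inr (Sum.inl a)
    | Sum.inr (Sum.inl j) => Sum.inl (Sum.inr j)
    | Sum.inr (Sum.inr j) => Sum.inr (Sum.inr j)
  invFun
    | Sum.inl (Sum.inl i) => Sum.inl (Sum.inl i)
    | Sum.inl (Sum.inr j) => Sum.inr (Sum.inl j)
    | Sum.inr (Sum.inl a) => Sum.inl (Sum.inr a)
    | Sum.inr (Sum.inr j) => Sum.inr (Sum.inr j)
  left_inv := by rintro ((i | a) | (j | j)) <;> rfl
  right_inv := by rintro ((i | j) | (a | j)) <;> rfl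

/-- `K_big = [[A, B♭], [B, 0]]` in its native indexing: `A = [[A_oo, A_ot], [A_to, A_tt]]` on bonds = non-tree ⊕ tree,
`B♭ = [[C_o♭, 0], [C_t♭, 1]]`, `B = [[C_o, C_t], [0, 1]]` (block-averaging rows, then the pinning rows). [folklore] -/
def kBig (Aoo : Matrix o o R) (Aot : Matrix o t R) (Ato : Matrix t o R) (Att : Matrix t t R) (Cof : Matrix o c R)
    (Ctf : Matrix t c R) (Co : Matrix c o R) (Ct : Matrix c t R) : Matrix ((o ⊕ t) ⊕ (c ⊕ t)) ((o ⊕ t) ⊕ (c ⊕ t)) R :=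
  fromBlocks (fromBlocks Aoo Aot Ato Att) (fromBlocks Cof 0 Ctf 1) (fromBlocks Co Ct 0 1) 0

/-- The reduced saddle matrix `k_off = [[A_oo, C_o♭], [C_o, 0]]` (tree variables deleted). [folklore] -/
def kOff (Aoo : Matrix o o R) (Cof : Matrix o c R) (Co : Matrix c o R) : Matrix (o ⊕ c) (o ⊕ c) R :=
  fromBlocks Aoo Cof Co 0

omit [Fintype o] [Fintype c] [Fintype t] [DecidableEq o] [DecidableEq c] in
/-- Regrouped, `K_big` IS the pinned matrix with `k_off` in the corner. [folklore] -/
theorem kBig_submatrix_regroup (Aoo : Matrix o o R) (Aot : Matrix o t R) (Ato : Matrix t o R) (Att : Matrix t t R)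
    (Cof : Matrix o c R) (Ctf : Matrix t c R) (Co : Matrix c o R) (Ct : Matrix c t R) :
    (kBig Aoo Aot Ato Att Cof Ctf Co Ct).submatrix (regroup o c t) (regroup o c t)
      = pinned (kOff Aoo Cof Co) Aot Ct Ato Ctf Att := by
  ext x y
  rcases x with ((i | a) | (j | j)) <;> rcases y with ((i' | a') | (j' | j')) <;> rfl

/-- TREE PINNING (S3), native form: `K_big` is invertible iff `k_off` is, [folklore] -/
theorem isUnit_det_kBig_iff (Aoo : Matrix o o R) (Aot : Matrix o t R) (Ato : Matrix t o R) (Att : Matrix t t R)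
    (Cof : Matrix o c R) (Ctf : Matrix t c R) (Co : Matrix c o R) (Ct : Matrix c t R) :
    IsUnit (kBig Aoo Aot Ato Att Cof Ctf Co Ct).det ↔ IsUnit (kOff Aoo Cof Co).det := by
  rw [← Matrix.det_submatrix_equiv_self (regroup o c t), kBig_submatrix_regroup, isUnit_det_pinned_iff]

/-- … and `(K_big⁻¹)[non-tree bonds ∪ block multipliers] = k_off⁻¹` entrywise, for ARBITRARY `A_ot`, `A_to`, `A_tt`,
`C_t`, `C_t♭`. [folklore] -/
theorem inv_kBig_apply (Aoo : Matrix o o R) (Aot : Matrix o t R) (Ato : Matrix t o R) (Att : Matrix t t R)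
    (Cof : Matrix o c R) (Ctf : Matrix t c R) (Co : Matrix c o R) (Ct : Matrix c t R)
    (hK : IsUnit (kOff Aoo Cof Co).det) (x y : o ⊕ c) :
    (kBig Aoo Aot Ato Att Cof Ctf Co Ct)⁻¹ (regroup o c t (Sum.inl x)) (regroup o c t (Sum.inl y))
      = (kOff Aoo Cof Co)⁻¹ x y := by
  have h := inv_pinned_toBlocks₁₁ (kOff Aoo Cof Co) Aot Ct Ato Ctf Att hK
  rw [← kBig_submatrix_regroup, Matrix.inv_submatrix_equiv] at h
  rw [← h]
  rfl

end TreePin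

end Summit.QuantumFields.BalabanUV.Beta.SaddleInverse
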